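import Mathlib.Analysis.InnerProductSpace.Basic
import HarnessLib

/-!
# Assembly of the finite-rank defect constant `M₁ = K₅ + K₆/(1−ε₄)²`

Analysis/OperatorTheory file (everything proved, no named facts). Abstract real inner product
spaces `E` (the energy space, `⟪·,·⟫_E`) and `F`, and a linear map `T : E →ₗ[ℝ] F` playing the
role of `Q^{1/2}` (so `‖T x‖² = ⟪Q x, x⟫`). Three elementary steps and their composition:

* **minimality of a `Q`-orthogonal projection** (`inner_Q_sub_le_of_proj`): if `⟪Q(f − g), ψ_i⟫ = 0`
  for all `i` and `g, h ∈ span ψ`, then `⟪Q(f − g), f − g⟫ ≤ ⟪Q(f − h), f − h⟫` (`Q` symmetric,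
  non-negative) — the step "`f_lg` minimises `‖Q^{1/2}(f − ·)‖` over `V_lg`";
* **quasi-orthogonality amplification** (`norm_le_of_quasiOrth`): if `x − p ⊥ g`, `s = x − p − g`
  and `|⟪g, s⟫| ≤ ε ‖g‖ ‖s‖` with `0 ≤ ε < 1`, then `‖g‖ ≤ ε ‖s‖` and `(1 − ε) ‖s‖ ≤ ‖x − p‖`;
  with `x − p ⊥ p` also `‖x − p‖ ≤ ‖x‖` (`norm_sub_le_norm_of_inner_eq_zero`);
* **weighted triangle / Cauchy–Schwarz** (`add_sq_le_weighted`, `norm_map_add_sq_le_weighted`): from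
  `‖T u‖² ≤ K ‖u‖²`-type bounds `‖T u‖² ≤ K α²`, `‖T v‖² ≤ L β²` follows
  `‖T (u + v)‖² ≤ (K + L)(α² + β²)` — square-root free, no AM–GM weight to choose;
* **the constant `M₁`** (`norm_map_add_sq_le_M1`): for `f = f_or + x` with `f_or ⊥ x`,
  `x = p + g + s` as above, `‖T f_or‖² ≤ K₅ ‖f_or‖²`, `‖T s‖² ≤ K₆ ‖s‖²`:
  `‖T (f_or + s)‖² ≤ (K₅ + K₆ / (1 − ε)²) ‖f‖²`.

## Why it is here

Elementary linear algebra ([folklore]). Kernel-checks the steps (c)–(d) of Lemma E.3 of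
`pub-nsjs/pub-nsjs-typer/LEMMA-E.md` (Jia–Šverák programme, certified-enclosure lane; the finite-rank
scheme is Hou–Wang–Yang's, arXiv:2509.25116 v2, Lemma "fe est" TeX L1765–1813 / App. L3918–4013,
under adjudication in that cell and NOT cited for this step — re-derived here), completing with
`GramMismatchProjection.lean` (E.1), `QuasiOrthogonalityResidual.lean` (E.2, corrected constant)
and `FiniteRankGramBound.lean` (E.4) the kernel coverage of the finite-dimensional algebra of
LEMMA-E. The analytic inputs (the definitions of `K₅`, `K₆`, the `E`-projection being the
`L²(Ω)`-projection, and Cauchy–Schwarz on `Ω × ℝ³` for `K₇`) enter only as hypotheses. Nothing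
about Navier–Stokes is typed here.
-/

open Finset

namespace Literature.Analysis.OperatorTheory

variable {E : Type*} [NormedAddCommGroup E] [InnerProductSpace ℝ E]
variable {F : Type*} [NormedAddCommGroup F] [InnerProductSpace ℝ F]
variable {ι : Type*} [Fintype ι]

/-- **Minimality of a `Q`-orthogonal projection.** If `⟪Q(f − g), ψ_i⟫ = 0` for all `i` with
`g = Σ d_j ψ_j`, then for every `h = Σ e_j ψ_j`, `⟪Q(f − g), f − g⟫ ≤ ⟪Q(f − h), f − h⟫`
(`Q` symmetric and non-negative). [folklore] -/
theorem inner_Q_sub_le_of_proj (Q : E →ₗ[ℝ] E)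
    (hsymm : ∀ x y, inner ℝ (Q x) y = inner ℝ x (Q y))
    (hnonneg : ∀ x, 0 ≤ inner ℝ (Q x) x) (ψ : ι → E) (f : E) (d e : ι → ℝ)
    (hproj : ∀ i, inner ℝ (Q (f - ∑ j, d j • ψ j)) (ψ i) = 0) :
    inner ℝ (Q (f - ∑ j, d j • ψ j)) (f - ∑ j, d j • ψ j)
      ≤ inner ℝ (Q (f - ∑ j, e j • ψ j)) (f - ∑ j, e j • ψ j) := by
  set g := ∑ j, d j • ψ j with hg
  set h := ∑ j, e j • ψ j with hh
  -- `g − h ∈ span ψ`, hence `⟪Q(f − g), g − h⟫ = 0`.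
  have h0 : inner ℝ (Q (f - g)) (g - h) = 0 := by
    have : g - h = ∑ j, (d j - e j) • ψ j := by
      rw [hg, hh, ← Finset.sum_sub_distrib]
      refine Finset.sum_congr rfl fun j _ => ?_
      rw [sub_smul]
    rw [this, inner_sum]
    refine Finset.sum_eq_zero fun i _ => ?_
    rw [real_inner_smul_right, hproj i, mul_zero]
  have h0' : inner ℝ (Q (g - h)) (f - g) = 0 := by
    rw [hsymm, real_inner_comm, h0]
  have hsplit : f - h = (f - g) + (g - h) := by abel
  have hexp : inner ℝ (Q (f - h)) (f - h)
      = inner ℝ (Q (f - g)) (f - g) + inner ℝ (Q (g - h)) (g - h) := by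
    rw [hsplit, map_add, inner_add_left, inner_add_right, inner_add_right, h0, h0']
    ring
  rw [hexp]
  linarith [hnonneg (g - h)]

/-- `‖x − p‖ ≤ ‖x‖` when `x − p ⊥ p` (an orthogonal projection shortens). [folklore] -/
theorem norm_sub_le_norm_of_inner_eq_zero (x p : E) (h : inner ℝ (x - p) p = 0) :
    ‖x - p‖ ≤ ‖x‖ := by
  have hx : x = (x - p) + p := by abel
  have hsq : ‖x‖ ^ 2 = ‖x - p‖ ^ 2 + ‖p‖ ^ 2 := by
    conv_lhs => rw [hx]
    have h2 : inner ℝ p (x - p) = 0 := by rw [real_inner_comm]; exact h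
    rw [← real_inner_self_eq_norm_sq, ← real_inner_self_eq_norm_sq,
      ← real_inner_self_eq_norm_sq, inner_add_left, inner_add_right, inner_add_right, h, h2]
    ring
  have : ‖x - p‖ ^ 2 ≤ ‖x‖ ^ 2 := by rw [hsq]; nlinarith [norm_nonneg p]
  exact (pow_le_pow_iff_left₀ (norm_nonneg _) (norm_nonneg _) two_ne_zero).mp this

/-- **Quasi-orthogonality amplification** (Lemma E.3, step (c)). With `x − p ⊥ g`,
`s = x − p − g` and `|⟪g, s⟫| ≤ ε ‖g‖ ‖s‖`, `0 ≤ ε`: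
`‖g‖ ≤ ε ‖s‖` and `(1 − ε) ‖s‖ ≤ ‖x − p‖`. [folklore] -/
theorem norm_le_of_quasiOrth (x p g s : E) (hs : s = x - p - g)
    (horth : inner ℝ (x - p) g = 0) {ε : ℝ} (hε0 : 0 ≤ ε)
    (hq : |inner ℝ g s| ≤ ε * ‖g‖ * ‖s‖) :
    ‖g‖ ≤ ε * ‖s‖ ∧ (1 - ε) * ‖s‖ ≤ ‖x - p‖ := by
  have hxp : x - p = s + g := by rw [hs]; abel
  have hgg : ‖g‖ ^ 2 = - inner ℝ g s := by
    have := horth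
    rw [hxp, inner_add_left, real_inner_self_eq_norm_sq, real_inner_comm] at this
    linarith
  have hg1 : ‖g‖ ≤ ε * ‖s‖ := by
    have h1 : ‖g‖ ^ 2 ≤ ε * ‖g‖ * ‖s‖ := by
      rw [hgg]; exact (neg_le_abs _).trans hq
    rcases (norm_nonneg g).lt_or_eq with hpos | hzero
    · have := h1
      nlinarith
    · rw [← hzero]; positivity
  refine ⟨hg1, ?_⟩
  have : ‖s‖ ≤ ‖x - p‖ + ‖g‖ := by
    have : s = (x - p) - g := hs
    rw [this]; exact norm_sub_le _ _
  nlinarith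

/-- Square-root-free weighted Cauchy–Schwarz: `a² ≤ K α²`, `b² ≤ L β²` (all non-negative) give
`(a + b)² ≤ (K + L)(α² + β²)` (`a, b, K, L ≥ 0`). [folklore] -/
theorem add_sq_le_weighted {a b K L α β : ℝ} (ha : 0 ≤ a) (hb : 0 ≤ b) (hK : 0 ≤ K)
    (hL : 0 ≤ L) (h1 : a ^ 2 ≤ K * α ^ 2) (h2 : b ^ 2 ≤ L * β ^ 2) :
    (a + b) ^ 2 ≤ (K + L) * (α ^ 2 + β ^ 2) := by
  -- `2ab ≤ K β² + L α²`: compare squares, `(2ab)² ≤ 4 K L α² β² ≤ (K β² + L α²)²`.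
  have hab : (2 * (a * b)) ^ 2 ≤ (K * β ^ 2 + L * α ^ 2) ^ 2 := by
    have h3 : (a * b) ^ 2 ≤ (K * α ^ 2) * (L * β ^ 2) := by
      rw [mul_pow]; exact mul_le_mul h1 h2 (by positivity) (by positivity)
    nlinarith [sq_nonneg (K * β ^ 2 - L * α ^ 2)]
  have hab' : 2 * (a * b) ≤ K * β ^ 2 + L * α ^ 2 :=
    (pow_le_pow_iff_left₀ (by positivity) (by positivity) two_ne_zero).mp hab
  nlinarith

/-- `‖T (u + v)‖² ≤ (K + L)(α² + β²)` from `‖T u‖² ≤ K α²`, `‖T v‖² ≤ L β²`. [folklore] -/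
theorem norm_map_add_sq_le_weighted (T : E →ₗ[ℝ] F) (u v : E) {K L α β : ℝ} (hK : 0 ≤ K)
    (hL : 0 ≤ L) (hu : ‖T u‖ ^ 2 ≤ K * α ^ 2)
    (hv : ‖T v‖ ^ 2 ≤ L * β ^ 2) :
    ‖T (u + v)‖ ^ 2 ≤ (K + L) * (α ^ 2 + β ^ 2) := by
  have htri : ‖T (u + v)‖ ≤ ‖T u‖ + ‖T v‖ := by rw [map_add]; exact norm_add_le _ _
  calc ‖T (u + v)‖ ^ 2 ≤ (‖T u‖ + ‖T v‖) ^ 2 := by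
        exact pow_le_pow_left₀ (norm_nonneg _) htri 2
    _ ≤ (K + L) * (α ^ 2 + β ^ 2) :=
        add_sq_le_weighted (norm_nonneg _) (norm_nonneg _) hK hL hu hv

/-- **The constant `M₁ = K₅ + K₆/(1 − ε)²`** (Lemma E.3, steps (c)–(d)). Let `f = f_or + x` with
`f_or ⊥ x`, `x = p + g + s` with `x − p ⊥ g`, `x − p ⊥ p`, `|⟪g, s⟫| ≤ ε ‖g‖ ‖s‖` (`0 ≤ ε < 1`),
and `‖T f_or‖² ≤ K₅ ‖f_or‖²`, `‖T s‖² ≤ K₆ ‖s‖²` (`K₅, K₆ ≥ 0`). Then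
`‖T (f_or + s)‖² ≤ (K₅ + K₆ / (1 − ε)²) ‖f‖²`. [folklore] -/
theorem norm_map_add_sq_le_M1 (T : E →ₗ[ℝ] F) (f f_or x p g s : E)
    (hf : f = f_or + x) (hfx : inner ℝ f_or x = 0) (hs : s = x - p - g)
    (horth : inner ℝ (x - p) g = 0) (hp : inner ℝ (x - p) p = 0)
    {ε K₅ K₆ : ℝ} (hε0 : 0 ≤ ε) (hε1 : ε < 1) (hK₅ : 0 ≤ K₅) (hK₆ : 0 ≤ K₆)
    (hq : |inner ℝ g s| ≤ ε * ‖g‖ * ‖s‖)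
    (h5 : ‖T f_or‖ ^ 2 ≤ K₅ * ‖f_or‖ ^ 2) (h6 : ‖T s‖ ^ 2 ≤ K₆ * ‖s‖ ^ 2) :
    ‖T (f_or + s)‖ ^ 2 ≤ (K₅ + K₆ / (1 - ε) ^ 2) * ‖f‖ ^ 2 := by
  have h1ε : 0 < 1 - ε := by linarith
  obtain ⟨-, hs'⟩ := norm_le_of_quasiOrth x p g s hs horth hε0 hq
  have hxp : ‖x - p‖ ≤ ‖x‖ := norm_sub_le_norm_of_inner_eq_zero x p hp
  -- `‖T s‖² ≤ K₆ ‖s‖² ≤ (K₆/(1−ε)²) ‖x‖²`.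
  have hs2 : ‖s‖ ^ 2 ≤ (1 / (1 - ε) ^ 2) * ‖x‖ ^ 2 := by
    have : (1 - ε) * ‖s‖ ≤ ‖x‖ := hs'.trans hxp
    have h2 : ((1 - ε) * ‖s‖) ^ 2 ≤ ‖x‖ ^ 2 :=
      pow_le_pow_left₀ (by positivity) this 2
    rw [mul_pow] at h2
    rw [div_mul_eq_mul_div, one_mul, le_div_iff₀ (by positivity)]
    linarith
  have h6' : ‖T s‖ ^ 2 ≤ (K₆ / (1 - ε) ^ 2) * ‖x‖ ^ 2 := by
    calc ‖T s‖ ^ 2 ≤ K₆ * ‖s‖ ^ 2 := h6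
      _ ≤ K₆ * ((1 / (1 - ε) ^ 2) * ‖x‖ ^ 2) := mul_le_mul_of_nonneg_left hs2 hK₆
      _ = (K₆ / (1 - ε) ^ 2) * ‖x‖ ^ 2 := by ring
  -- Pythagoras: `‖f‖² = ‖f_or‖² + ‖x‖²`.
  have hpyth : ‖f‖ ^ 2 = ‖f_or‖ ^ 2 + ‖x‖ ^ 2 := by
    rw [hf, ← real_inner_self_eq_norm_sq, ← real_inner_self_eq_norm_sq,
      ← real_inner_self_eq_norm_sq, inner_add_left, inner_add_right, inner_add_right, hfx,
      show inner ℝ x f_or = 0 by rw [real_inner_comm]; exact hfx]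
    ring
  rw [hpyth]
  exact norm_map_add_sq_le_weighted T f_or s hK₅ (by positivity) h5 h6'

end Literature.Analysis.OperatorTheory
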